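import Mathlib
import Summits.KontsevichZagierPeriods.Statement
import Literature.NumberTheory.Transcendental.KZRelationsLE

/-!
# Crux PlanarAreas (stmt-KontsevichZagierPeriods-4990) — ideator 2, round 1: first lemmas of two lines

* `SheetCauchy` — idea `sheets-over-planar-triangles`: Cauchy–Goursat for a function that is
  `ℚ`-semialgebraic and continuous on the closed standard triangle `Δ ⊂ ℂ` and holomorphic inside,
  written as the relation `[e₀₁] + [e₁₂] − [e₀₂] ≡ 0` among the three 1-dimensional
  representations of `Re (w dz)` along the edges, INSIDE DIMENSION ≤ 2 (`KZ.relationsLE 2`):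
  two Newton–Leibniz moves on `Δ` whose primitives are the coefficients `Re w`, `−Im w` themselves.
  Every (R5)-instance of Huber–Wüstholz's certificate becomes this after projecting the curve to the
  `x`-line and triangulating the plane (branch points and marked points as vertices).
* `RealIsogenyOneMove` — idea `real-descent-klein-fold`: a real `x`-rational map `R` with
  `g (R x) · c² = R′(x)² · f x` carries `[I, c/√f]` onto `[R(I), 1/√g]` by ONE change of variables;
  `TwistThreeIsogeny` is the instance `y² = x³ − 1 → y² = x³ + 1`, `R = (x³ − 4)/(3x²)`, `c = √3`
  (the "non-real CM identity" `∫_{-∞}^{1} dx/√(1−x³) = √3 ∫_1^∞ dx/√(x³−1)` as a REAL 3-isogeny to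
  the twist).
-/

namespace Summit.KontsevichZagierPeriods.KontsevichZagierPeriods.Cruxes.PlanarAreas.SketchIdeator2

open Literature.NumberTheory.Transcendental

/-- Idea `sheets-over-planar-triangles`, first lemma. For `w : ℂ → ℂ` continuous and
`ℚ`-semialgebraic (real and imaginary parts) on the closed standard triangle
`Δ = {0 ≤ a, 0 ≤ b, a + b ≤ 1}` (`z = a + b i`) and complex-differentiable on the open triangle, the
three edge representations of `Re (w dz)` — `e₀₁ : t ↦ Re w(t)`, `e₁₂ : t ↦ −Re w − Im w` at
`(1 − t) + t i` (velocity `−1 + i`), `e₀₂ : t ↦ −Im w(t i)` (velocity `i`) — satisfy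
`[e₀₁] + [e₁₂] − [e₀₂] ∈ relationsLE 2`. (Apply to `−i·w` for `Im (w dz)`.) -/
def SheetCauchy : Prop :=
  ∀ (w : ℂ → ℂ) (r₀₁ r₁₂ r₀₂ : KZ.IntegralRep 1),
    ContinuousOn w {z : ℂ | 0 ≤ z.re ∧ 0 ≤ z.im ∧ z.re + z.im ≤ 1} →
    DifferentiableOn ℂ w {z : ℂ | 0 < z.re ∧ 0 < z.im ∧ z.re + z.im < 1} →
    IsSemialgebraicFunOn ℚ {p : Fin 2 → ℝ | 0 ≤ p 0 ∧ 0 ≤ p 1 ∧ p 0 + p 1 ≤ 1}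
      (fun p => (w ((p 0 : ℂ) + (p 1 : ℂ) * Complex.I)).re) →
    IsSemialgebraicFunOn ℚ {p : Fin 2 → ℝ | 0 ≤ p 0 ∧ 0 ≤ p 1 ∧ p 0 + p 1 ≤ 1}
      (fun p => (w ((p 0 : ℂ) + (p 1 : ℂ) * Complex.I)).im) →
    r₀₁.domain = {z | z 0 ∈ Set.Ioo (0 : ℝ) 1} →
    r₁₂.domain = {z | z 0 ∈ Set.Ioo (0 : ℝ) 1} →
    r₀₂.domain = {z | z 0 ∈ Set.Ioo (0 : ℝ) 1} →
    (∀ z ∈ r₀₁.domain, r₀₁.integrand z = (w (z 0 : ℂ)).re) →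
    (∀ z ∈ r₁₂.domain, r₁₂.integrand z =
        -(w (((1 - z 0 : ℝ) : ℂ) + (z 0 : ℂ) * Complex.I)).re
          - (w (((1 - z 0 : ℝ) : ℂ) + (z 0 : ℂ) * Complex.I)).im) →
    (∀ z ∈ r₀₂.domain, r₀₂.integrand z = -(w ((z 0 : ℂ) * Complex.I)).im) →
    KZ.of r₀₁ + KZ.of r₁₂ - KZ.of r₀₂ ∈ KZ.relationsLE 2

/-- Idea `real-descent-klein-fold`, first lemma (the engine of the genus-one layer). A real
`x`-map `R` (strictly increasing, differentiable, `ℚ`-semialgebraic on `(a, b)`) with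
`g (R x) · c² = R′(x)² · f x` carries the representation `[(a,b), c/√f]` onto
`[R (a,b), 1/√g]` by ONE change-of-variables move: `c/√(f x) = (1/√(g (R x))) · |R′ x|`. Real
isogenies, real translations and real automorphisms of real hyperelliptic curves `y² = f` all have
this shape on the Kummer line. -/
def RealIsogenyOneMove : Prop :=
  ∀ (a b c : ℝ) (f g R : ℝ → ℝ), a < b → 0 < c →
    IsSemialgebraicFunOn ℚ {z : Fin 1 → ℝ | z 0 ∈ Set.Ioo a b} (fun z => f (z 0)) →
    IsSemialgebraicFunOn ℚ {z : Fin 1 → ℝ | z 0 ∈ R '' Set.Ioo a b} (fun z => g (z 0)) →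
    IsSemialgebraicFunOn ℚ {z : Fin 1 → ℝ | z 0 ∈ Set.Ioo a b} (fun z => R (z 0)) →
    DifferentiableOn ℝ R (Set.Ioo a b) →
    (∀ x ∈ Set.Ioo a b, 0 < f x ∧ 0 < deriv R x ∧ 0 < g (R x)) →
    (∀ x ∈ Set.Ioo a b, g (R x) * c ^ 2 = deriv R x ^ 2 * f x) →
    ∀ (r r' : KZ.IntegralRep 1),
      r.domain = {z | z 0 ∈ Set.Ioo a b} →
      r'.domain = {z | z 0 ∈ R '' Set.Ioo a b} →
      (∀ z ∈ r.domain, r.integrand z = c / Real.sqrt (f (z 0))) →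
      (∀ z ∈ r'.domain, r'.integrand z = 1 / Real.sqrt (g (z 0))) →
      KZ.of r - KZ.of r' ∈ KZ.changeOfVariablesRel

/-- Idea `real-descent-klein-fold`, calibration: the "non-real CM identity" on `y² = x³ − 1`
(CM by `ζ₃`), `∫_{-∞}^{1} dx/√(1 − x³) = √3 · ∫_1^∞ dx/√(x³ − 1)` (`4.2065463160` both sides), is the
REAL 3-isogeny `(imaginary twist-isomorphism) ∘ (imaginary multiplier √−3)` from `y² = x³ − 1` to
`y² = x³ + 1`: `x′ = (x³ − 4)/(3x²)` maps `(1, ∞)` increasingly onto `(−1, ∞)` with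
`(x′³ + 1) · 3 = ((x³ + 8)/(3x³))² · (x³ − 1)` — ONE change-of-variables move. -/
def TwistThreeIsogeny : Prop :=
  ∀ (r r' : KZ.IntegralRep 1),
    r.domain = {z | 1 < z 0} → r'.domain = {z | -1 < z 0} →
    (∀ z ∈ r.domain, r.integrand z = Real.sqrt 3 / Real.sqrt (z 0 ^ 3 - 1)) →
    (∀ z ∈ r'.domain, r'.integrand z = 1 / Real.sqrt (z 0 ^ 3 + 1)) →
    KZ.of r - KZ.of r' ∈ KZ.changeOfVariablesRel

/-- The algebraic identity behind `TwistThreeIsogeny` (checked by `ring` after clearing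
denominators): `27 x⁶ (R³ + 1) = (x³ − 1)(x³ + 8)²` with `R = (x³ − 4)/(3x²)`, i.e.
`(x³ − 4)³ + 27x⁶ = (x³ − 1)(x³ + 8)²`. -/
theorem twist_identity (x : ℝ) :
    (x ^ 3 - 4) ^ 3 + 27 * x ^ 6 = (x ^ 3 - 1) * (x ^ 3 + 8) ^ 2 := by
  ring

end Summit.KontsevichZagierPeriods.KontsevichZagierPeriods.Cruxes.PlanarAreas.SketchIdeator2
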